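import Summits.SmoothPoincare4.SmoothPoincare4.Theorems.ConvexBisectionAcyclicBisectionExistsPageRotationField
import Literature.Geometry.Manifold.VectorSpaceGlobalFlow
import Literature.Topology.FourManifolds.RegularDomainMaps
import HarnessLib

/-!
# The flow of the page-rotation field: invariance of the base, rotation of the pages
(wave 3, brick T1a, part 3, of stub `stub_steinRealisation` = NF6
`Literature.Geometry.Symplectic.steinRealisation_of_sorted_modelsOnFibred`, line `modp-braid-orbits`
r11, crux `ConvexBisection.AcyclicBisectionExists`, item stmt-SmoothPoincare4-10508; registered
sub-goal `helper_rotFlow_page`)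

The page-rotation field `rotField g` of the prequel (`…PageRotationField.lean`: smooth, supported
in `{rho ≤ 2/5}`, `d rho(V) = 0`, `dw(V) = i w` on `{rho ≤ 3/10}`, `dx(V) = 0` over `‖x‖² ≥ 7/2`)
is run here at a variable angular speed `a(w)` (`a : ℂ → ℝ` smooth, a function of the page
coordinate `w = y² − x^{2g+1} − 1` — constant: rigid rotation of all pages; a bump in the page
angle: only a block of pages turns, which is how the page angles `pageDir (m+n) i ↦ pageDir m i`
of a split Lefschetz link will be re-spaced one letter at a time, NF6 T1b), and its flow is
restricted to the base:

* §1 `rotFieldA g a = a(w) · rotField g` and its three identities;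
* §2–§3 invariants along any integral curve `γ` of `rotFieldA g a` (chain rule + `d rho(V) = 0`,
  `is_const_of_deriv_eq_zero`): `rho ∘ γ` is constant (`rho_flowline_eq`); the RIM GAUGE
  `rimGauge ‖x‖²` (`smoothTransition`, flat below `18/5`, equal to `1` exactly over `‖x‖² ≥ 4`) is
  constant, because where it is not flat the field does not move `x` — so **`‖x(γ t)‖² < 4` iff
  `‖x(γ 0)‖² < 4`** (`norm_sq_cx_flowline_lt_four_iff`: the flat part carrying the pages is invariant
  in both time directions, with no shrinking); **`(w ∘ γ)' = a(w) · i · w`** from `{rho ≤ 3/10}`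
  (`hasDerivAt_w_flowline`), whence `‖w‖` is constant and, for a constant profile `κ`,
  `w(γ t) = e^{iκt} w(γ 0)` (`w_flowline_eq_exp_mul`);
* §4 the global smooth flow `θ` of `rotFieldA g a` (compact support: the tree's
  `Literature.Geometry.Manifold.exists_contDiff_globalFlow`, Lee 2012 Thm. 9.16);
* §5 **a smooth `rho`-preserving flow of `ℝ⁴` restricts to an `AmbientIsotopy (𝓡∂ 4) (Base g)`**
  (`baseIsotopy`: stages `baseStage`, jointly smooth into the regular domain `{rho ≤ 1/4}` by the
  tree's `HalfSliceAtlas.contMDiff_codRestrict`, Lee Cor. 5.30; each stage a diffeomorphism with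
  inverse the stage at `−t`);
* §6 `helper_rotFlow_page` — the package: an ambient isotopy `R` of `Base g` with
  `(R_t x).1 = θ(t, x.1)`, `rho` invariant, `‖x‖² < 4` invariant, `(w ∘ R_· x)' = a(w) i w`,
  `‖w‖` invariant, and for `a ≡ κ`: `R_t (page g c) ⊆ page g (e^{iκt} c)`.

What remains of NF6 T1 after this file: the angular schedule (profiles `a_i` realising
`pageDir (m+n) i ↦ pageDir m i`, by ODE uniqueness in `ℂ` against the clause `(w ∘ R)' = a(w) i w`),
and the transport of `IsLefschetzLink` / `IsLefschetzHandlebody` along `R` (shadow: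
`…PageInvariance.lean`; twisting: `…PageInvarianceTwisting.lean` + non-vanishing of the twisting
loop).  Everything here is proved; no named facts, no `sorry`.  References: R. İ. Baykur, *Kähler
decomposition of 4-manifolds*, AGT 6 (2006), proof of Thm. 5.1 [Baykur2006]; M. W. Hirsch,
*Differential Topology* (1976), Ch. 8 §1 [HirschDT1976]; J. M. Lee, *Introduction to Smooth
Manifolds* (2012), Thm. 9.12, 9.16, Cor. 5.30 [LeeSmoothManifolds2013].
-/

noncomputable section

set_option linter.dupNamespace false

open scoped Manifold ContDiff Topology ComplexConjugate
open Set Function Metric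
open Literature.Topology.FourManifolds Literature.Topology.FourManifolds.LefschetzBase

namespace Summit.SmoothPoincare4.SmoothPoincare4.Theorems.AcyclicBisectionExists.ModpBraidOrbits

variable {g : ℕ} {a : ℂ → ℝ}

/-! ## §1 The profiled rotation field `a(w) · rotField` -/

/-- **The profiled page-rotation field** `a(w(q)) · rotField g q`: the rotation field run at the
angular speed `a`, a smooth function of the page coordinate `w` (constant `a`: rigid rotation of
all pages; a bump in the page angle: rotation of a block of pages only). [folklore] -/
def rotFieldA (g : ℕ) (a : ℂ → ℝ) (q : EuclideanSpace ℝ (Fin 4)) : EuclideanSpace ℝ (Fin 4) :=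
  a (w g q) • rotField g q

/-- The profiled field is smooth. [folklore] -/
theorem contDiff_rotFieldA (ha : ContDiff ℝ ∞ a) : ContDiff ℝ ∞ (rotFieldA g a) :=
  (ha.comp (contDiff_w g)).smul (contDiff_rotField g)

/-- The profiled field vanishes off `{rho ≤ 2/5}`. [folklore] -/
theorem rotFieldA_eq_zero_of_not_mem {q : EuclideanSpace ℝ (Fin 4)}
    (hq : q ∉ (rho g ⁻¹' Iic (2 / 5) : Set (EuclideanSpace ℝ (Fin 4)))) : rotFieldA g a q = 0 := by
  rw [rotFieldA, rotField_eq_zero_of_not_mem hq, smul_zero]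

/-- `d rho (a · rotField) = 0` everywhere. [folklore] -/
theorem fderiv_rho_rotFieldA (q : EuclideanSpace ℝ (Fin 4)) :
    fderiv ℝ (rho g) q (rotFieldA g a q) = 0 := by
  rw [rotFieldA, map_smul, fderiv_rho_rotField, smul_zero]

/-- `dw (a · rotField) = a · i w` on `{rho ≤ 3/10}`. [folklore] -/
theorem fderiv_w_rotFieldA_of_le {q : EuclideanSpace ℝ (Fin 4)} (h : rho g q ≤ 3 / 10) :
    fderiv ℝ (w g) q (rotFieldA g a q) = (a (w g q) : ℂ) * (Complex.I * w g q) := by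
  rw [rotFieldA, map_smul, fderiv_w_rotField_of_le h, Complex.real_smul]

/-- `dx (a · rotField) = 0` over `‖x‖² ≥ 7/2`. [folklore] -/
theorem cx_rotFieldA_of_ge {q : EuclideanSpace ℝ (Fin 4)} (h : 7 / 2 ≤ ‖cx q‖ ^ 2) :
    cx (rotFieldA g a q) = 0 := by
  rw [rotFieldA, cx_smul, cx_rotField_of_ge h, mul_zero]

/-! ## §2 The rim gauge: a first integral detecting `‖x‖² < 4` -/

/-- The rim gauge `smoothTransition ((s − 18/5) · 5/2)`: `0` for `s ≤ 18/5`, `1` exactly for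
`s ≥ 4`; composed with `‖x‖²` it is a first integral of the rotation fields. [folklore] -/
def rimGauge (s : ℝ) : ℝ := Real.smoothTransition ((s - 18 / 5) * (5 / 2))

/-- `rimGauge s = 1 ↔ 4 ≤ s`. [folklore] -/
theorem rimGauge_eq_one_iff {s : ℝ} : rimGauge s = 1 ↔ 4 ≤ s := by
  rw [rimGauge, Real.smoothTransition.eq_one_iff_one_le]
  constructor <;> intro h <;> linarith

/-- The rim gauge is differentiable. [folklore] -/
theorem differentiable_rimGauge : Differentiable ℝ rimGauge :=
  ((Real.smoothTransition.contDiff (n := ⊤)).differentiable (by simp)).comp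
    ((differentiable_id.sub_const _).mul_const _)

/-- The rim gauge is locally constant below `18/5`. [folklore] -/
theorem hasDerivAt_rimGauge_of_lt {s : ℝ} (h : s < 18 / 5) : HasDerivAt rimGauge 0 s := by
  refine (hasDerivAt_const s (0 : ℝ)).congr_of_eventuallyEq ?_
  filter_upwards [gt_mem_nhds h] with u hu
  exact Real.smoothTransition.zero_of_nonpos (by nlinarith)

/-! ## §3 Invariants along integral curves of the profiled field -/

section Curve

variable {γ : ℝ → EuclideanSpace ℝ (Fin 4)} (hγ : ∀ t, HasDerivAt γ (rotFieldA g a (γ t)) t)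
include hγ

/-- `rho` is constant along integral curves (derivative `d rho(V) = 0`). [folklore] -/
theorem hasDerivAt_rho_flowline (t : ℝ) : HasDerivAt (fun s => rho g (γ s)) 0 t := by
  have h := (((contDiff_rho g).differentiable (by simp)) (γ t)).hasFDerivAt.comp_hasDerivAt t
    (hγ t)
  rwa [fderiv_rho_rotFieldA] at h

/-- **`rho` is a first integral**: the flow preserves every level of `rho`, in particular the
base `{rho ≤ 1/4}` and its boundary `{rho = 1/4}`. [folklore] -/
theorem rho_flowline_eq (t : ℝ) : rho g (γ t) = rho g (γ 0) :=
  is_const_of_deriv_eq_zero (fun s => (hasDerivAt_rho_flowline hγ s).differentiableAt)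
    (fun s => (hasDerivAt_rho_flowline hγ s).deriv) t 0

/-- The coordinate `x` along an integral curve. [folklore] -/
theorem hasDerivAt_cx_flowline (t : ℝ) : HasDerivAt (fun s => cx (γ s)) (cx (rotFieldA g a (γ t))) t := by
  have h := cxL.hasFDerivAt.comp_hasDerivAt t (hγ t)
  simpa only [Function.comp_def, cxL_apply] using h

/-- The rim gauge of `‖x‖²` is constant along integral curves: below `18/5` the gauge is flat,
above `7/2` the field does not move `x`. [folklore] -/
theorem hasDerivAt_rimGauge_flowline (t : ℝ) :
    HasDerivAt (fun s => rimGauge (‖cx (γ s)‖ ^ 2)) 0 t := by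
  have h1 := hasDerivAt_norm_sq_comp (hasDerivAt_cx_flowline hγ t)
  by_cases hx : 7 / 2 ≤ ‖cx (γ t)‖ ^ 2
  · rw [cx_rotFieldA_of_ge hx, mul_zero, Complex.zero_re, mul_zero] at h1
    have h2 := ((differentiable_rimGauge (‖cx (γ t)‖ ^ 2)).hasDerivAt).comp t h1
    rwa [mul_zero] at h2
  · have h2 := (hasDerivAt_rimGauge_of_lt (s := ‖cx (γ t)‖ ^ 2) (by linarith [not_le.1 hx])).comp
      t h1
    rwa [zero_mul] at h2

/-- **The flat part `‖x‖² < 4` (which carries the pages) is invariant in both time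
directions.** [folklore] -/
theorem norm_sq_cx_flowline_lt_four_iff (t : ℝ) : ‖cx (γ t)‖ ^ 2 < 4 ↔ ‖cx (γ 0)‖ ^ 2 < 4 := by
  have h : rimGauge (‖cx (γ t)‖ ^ 2) = rimGauge (‖cx (γ 0)‖ ^ 2) :=
    is_const_of_deriv_eq_zero (fun s => (hasDerivAt_rimGauge_flowline hγ s).differentiableAt)
      (fun s => (hasDerivAt_rimGauge_flowline hγ s).deriv) t 0
  have h' : (4 ≤ ‖cx (γ t)‖ ^ 2) ↔ (4 ≤ ‖cx (γ 0)‖ ^ 2) := by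
    rw [← rimGauge_eq_one_iff, ← rimGauge_eq_one_iff, h]
  constructor <;> intro hlt <;> by_contra hge
  · exact absurd (h'.2 (not_lt.1 hge)) (not_le.2 hlt)
  · exact absurd (h'.1 (not_lt.1 hge)) (not_le.2 hlt)

/-- **The page coordinate rotates**: along an integral curve starting in `{rho ≤ 3/10}`,
`(w ∘ γ)' = a(w) · i · w`. [folklore] -/
theorem hasDerivAt_w_flowline (h0 : rho g (γ 0) ≤ 3 / 10) (t : ℝ) :
    HasDerivAt (fun s => w g (γ s)) ((a (w g (γ t)) : ℂ) * (Complex.I * w g (γ t))) t := by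
  have h := (((contDiff_w g).differentiable (by simp)) (γ t)).hasFDerivAt.comp_hasDerivAt t (hγ t)
  rwa [fderiv_w_rotFieldA_of_le ((rho_flowline_eq hγ t).le.trans h0)] at h

/-- `‖w‖` is constant along integral curves starting in `{rho ≤ 3/10}`. [folklore] -/
theorem norm_w_flowline_eq (h0 : rho g (γ 0) ≤ 3 / 10) (t : ℝ) : ‖w g (γ t)‖ = ‖w g (γ 0)‖ := by
  have hd : ∀ s, HasDerivAt (fun s => ‖w g (γ s)‖ ^ 2) 0 s := fun s => by
    refine (hasDerivAt_norm_sq_comp (hasDerivAt_w_flowline hγ h0 s)).congr_deriv ?_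
    have e : conj (w g (γ s)) * ((a (w g (γ s)) : ℂ) * (Complex.I * w g (γ s))) =
        ((a (w g (γ s)) * ‖w g (γ s)‖ ^ 2 : ℝ) : ℂ) * Complex.I := by
      push_cast
      rw [← Complex.conj_mul']
      ring
    rw [e, Complex.re_ofReal_mul, Complex.I_re, mul_zero, mul_zero]
  have h := is_const_of_deriv_eq_zero (fun s => (hd s).differentiableAt) (fun s => (hd s).deriv) t 0
  exact (sq_eq_sq₀ (norm_nonneg _) (norm_nonneg _)).1 h

/-- **Rigid rotation at constant speed**: if the profile equals `κ` along the curve (e.g. `a ≡ κ`),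
then `w(γ t) = e^{iκt} · w(γ 0)`. [folklore] -/
theorem w_flowline_eq_exp_mul (h0 : rho g (γ 0) ≤ 3 / 10) {κ : ℝ} (hκ : ∀ s, a (w g (γ s)) = κ)
    (t : ℝ) : w g (γ t) = Complex.exp (Complex.I * κ * t) * w g (γ 0) := by
  have hd : ∀ s : ℝ,
      HasDerivAt (fun s : ℝ => Complex.exp (-(Complex.I * κ * s)) * w g (γ s)) 0 s := by
    intro s
    have h1 : HasDerivAt (fun u : ℝ => -(Complex.I * κ * u)) (-(Complex.I * κ)) s := by
      have h := ((hasDerivAt_ofReal' s).const_mul (Complex.I * κ)).neg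
      rwa [mul_one] at h
    have he := (Complex.hasDerivAt_exp (-(Complex.I * κ * s))).comp s h1
    refine (he.mul (hasDerivAt_w_flowline hγ h0 s)).congr_deriv ?_
    rw [hκ s]
    simp only [Function.comp_def]
    ring
  have hc := is_const_of_deriv_eq_zero (fun s => (hd s).differentiableAt) (fun s => (hd s).deriv) t 0
  simp only [Complex.ofReal_zero, mul_zero, neg_zero, Complex.exp_zero, one_mul] at hc
  calc w g (γ t) = Complex.exp (Complex.I * κ * t) *
        (Complex.exp (-(Complex.I * κ * t)) * w g (γ t)) := by
          rw [← mul_assoc, ← Complex.exp_add, add_neg_cancel, Complex.exp_zero, one_mul]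
    _ = Complex.exp (Complex.I * κ * t) * w g (γ 0) := by rw [hc]

end Curve

/-! ## §4 The global flow of the profiled field -/

/-- **The profiled rotation field has a smooth complete flow** `θ : ℝ × ℝ⁴ → ℝ⁴` (compact
support, Lee 2012 Thm. 9.16: the tree's `exists_contDiff_globalFlow`).
[cite: LeeSmoothManifolds2013, Thm. 9.16 and Thm. 9.12] -/
theorem exists_rotFlow (g : ℕ) (ha : ContDiff ℝ ∞ a) :
    ∃ θ : ℝ × EuclideanSpace ℝ (Fin 4) → EuclideanSpace ℝ (Fin 4), ContDiff ℝ ∞ θ ∧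
      (∀ x, θ (0, x) = x) ∧ (∀ t s x, θ (t, θ (s, x)) = θ (t + s, x)) ∧
      ∀ x t, HasDerivAt (fun t => θ (t, x)) (rotFieldA g a (θ (t, x))) t := by
  obtain ⟨θ, hθ, h0, hadd, hder, -⟩ := Literature.Geometry.Manifold.exists_contDiff_globalFlow
    (contDiff_rotFieldA (g := g) ha) (isCompact_rho_le_two_fifths g)
    (fun x hx => rotFieldA_eq_zero_of_not_mem hx)
  exact ⟨θ, hθ, h0, hadd, hder⟩

/-! ## §5 A flow preserving `rho` restricts to an ambient isotopy of the base -/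

section Base

variable (θ : ℝ × EuclideanSpace ℝ (Fin 4) → EuclideanSpace ℝ (Fin 4))
  (hrho : ∀ t x, rho g (θ (t, x)) = rho g x)

/-- The stages of a `rho`-preserving flow of `ℝ⁴`, restricted to the base `{rho ≤ 1/4}`.
[folklore] -/
def baseStage (t : ℝ) (x : Base g) : Base g :=
  ⟨θ (t, x.1), show rho g (θ (t, x.1)) ≤ 1 / 4 from (hrho t x.1).le.trans x.2⟩

/-- The restricted stage, read in `ℝ⁴`. [folklore] -/
@[simp] theorem coe_baseStage (t : ℝ) (x : Base g) : (baseStage θ hrho t x).1 = θ (t, x.1) := rfl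

variable {θ}

/-- **The restricted stages are jointly smooth** for the manifold-with-boundary structure of the
base (smooth maps into a regular domain: `HalfSliceAtlas.contMDiff_codRestrict`).
[cite: LeeSmoothManifolds2013, Cor. 5.30] -/
theorem contMDiff_uncurry_baseStage (hθ : ContDiff ℝ ∞ θ) :
    ContMDiff (𝓘(ℝ, ℝ).prod (𝓡∂ 4)) (𝓡∂ 4) ∞ (uncurry (baseStage (g := g) θ hrho)) := by
  have h1 : ContMDiff (𝓘(ℝ, ℝ).prod (𝓡∂ 4)) (𝓘(ℝ, ℝ).prod (𝓡 4)) ∞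
      (fun p : ℝ × Base g => (p.1, p.2.1)) :=
    contMDiff_fst.prodMk ((RegularSublevel.contMDiff_incl (isRegularLevel_rho g)).comp contMDiff_snd)
  have h2 : ContMDiff (𝓘(ℝ, ℝ).prod (𝓡 4)) (𝓡 4) ∞ θ := by
    rw [← modelWithCornersSelf_prod, chartedSpaceSelf_prod]
    exact hθ.contMDiff
  exact (RegularSublevel.halfSliceAtlas (isRegularLevel_rho g)).contMDiff_codRestrict
    (fun p : ℝ × Base g => show rho g (θ (p.1, p.2.1)) ≤ 1 / 4 from
      (hrho p.1 p.2.1).le.trans p.2.2) (h2.comp h1)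

/-- Each restricted stage is smooth. [cite: LeeSmoothManifolds2013, Cor. 5.30] -/
theorem contMDiff_baseStage (hθ : ContDiff ℝ ∞ θ) (t : ℝ) :
    ContMDiff (𝓡∂ 4) (𝓡∂ 4) ∞ (baseStage (g := g) θ hrho t) :=
  (contMDiff_uncurry_baseStage hrho hθ).comp (contMDiff_const.prodMk contMDiff_id)

variable (h0 : ∀ x, θ (0, x) = x) (hadd : ∀ t s x, θ (t, θ (s, x)) = θ (t + s, x))

/-- The restricted stage at time `t` as a diffeomorphism of the base, with inverse the stage at
time `−t` (group law). [folklore] -/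
def baseStageDiffeo (hθ : ContDiff ℝ ∞ θ) (t : ℝ) : Base g ≃ₘ^∞⟮𝓡∂ 4, 𝓡∂ 4⟯ Base g where
  toFun := baseStage θ hrho t
  invFun := baseStage θ hrho (-t)
  left_inv x := Subtype.ext (by simp only [coe_baseStage, hadd, neg_add_cancel, h0])
  right_inv x := Subtype.ext (by simp only [coe_baseStage, hadd, add_neg_cancel, h0])
  contMDiff_toFun := contMDiff_baseStage hrho hθ t
  contMDiff_invFun := contMDiff_baseStage hrho hθ (-t)

/-- **A smooth `rho`-preserving flow of `ℝ⁴` restricts to an ambient isotopy of the base.**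
[cite: HirschDT1976, Ch. 8 §1, Thms. 1.1–1.2] -/
def baseIsotopy (hθ : ContDiff ℝ ∞ θ) : AmbientIsotopy (𝓡∂ 4) (Base g) where
  toFun := baseStage θ hrho
  contMDiff := contMDiff_uncurry_baseStage hrho hθ
  bijective t := (baseStageDiffeo hrho h0 hadd hθ t).bijective
  isLocalDiffeomorph t := (baseStageDiffeo hrho h0 hadd hθ t).isLocalDiffeomorph
  map_zero := funext fun x => Subtype.ext (h0 x.1)

/-- The stages of the restricted isotopy, read in `ℝ⁴`. [folklore] -/
@[simp] theorem coe_baseIsotopy_toFun (hθ : ContDiff ℝ ∞ θ) (t : ℝ) (x : Base g) :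
    ((baseIsotopy hrho h0 hadd hθ).toFun t x).1 = θ (t, x.1) := rfl

end Base

/-! ## §6 The registered sub-goal: the page-rotation isotopy of the base -/

/-- **(R2) The page-rotation isotopy of the Lefschetz base** (registered sub-goal
`helper_rotFlow_page` of NF6, brick T1a): for every smooth angular-speed profile `a : ℂ → ℝ`
there is an ambient isotopy `R` of `Base g` (the flow of `a(w) · rotField g` restricted to the
base), the restriction of a smooth flow `θ` of `ℝ⁴`, which preserves every level of `rho`
(so `∂ Base g` and the interior), preserves the flat part `‖x‖² < 4` carrying the pages in both
time directions, turns the page coordinate according to `(w ∘ R_· x)' = a(w) · i · w` keeping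
`‖w‖` fixed — hence is FIBRED: pages go to pages — and, for a constant profile `a ≡ κ`, rotates the
pages rigidly: `R_t (page g c) ⊆ page g (e^{iκt} c)`.  This is the fibred isotopy of
`F × D² ≅ Base g` re-spacing the page angles of a Lefschetz link (Baykur 2006, proof of Thm. 5.1;
Gompf–Stipsicz 1999, §8.2), generated by Hirsch's flow of a compactly supported field.
[cite: Baykur2006, proof of Thm. 5.1, pp. 13–14] -/
theorem helper_rotFlow_page :
    ∀ (g : ℕ) (a : ℂ → ℝ), ContDiff ℝ ∞ a →
      ∃ (R : Literature.Topology.FourManifolds.AmbientIsotopy (𝓡∂ 4)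
          (Literature.Topology.FourManifolds.LefschetzBase.Base g))
        (θ : ℝ × EuclideanSpace ℝ (Fin 4) → EuclideanSpace ℝ (Fin 4)),
        ContDiff ℝ ∞ θ ∧ (∀ x, θ (0, x) = x) ∧ (∀ t s x, θ (t, θ (s, x)) = θ (t + s, x)) ∧
        (∀ (t : ℝ) (x : Literature.Topology.FourManifolds.LefschetzBase.Base g),
          (R.toFun t x).1 = θ (t, x.1)) ∧
        (∀ t x, Literature.Topology.FourManifolds.LefschetzBase.rho g (θ (t, x)) =
          Literature.Topology.FourManifolds.LefschetzBase.rho g x) ∧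
        (∀ t x, ‖Literature.Topology.FourManifolds.LefschetzBase.cx (θ (t, x))‖ ^ 2 < 4 ↔
          ‖Literature.Topology.FourManifolds.LefschetzBase.cx x‖ ^ 2 < 4) ∧
        (∀ x, Literature.Topology.FourManifolds.LefschetzBase.rho g x ≤ 3 / 10 → ∀ t,
          HasDerivAt (fun s => Literature.Topology.FourManifolds.LefschetzBase.w g (θ (s, x)))
            ((a (Literature.Topology.FourManifolds.LefschetzBase.w g (θ (t, x))) : ℂ) *
              (Complex.I * Literature.Topology.FourManifolds.LefschetzBase.w g (θ (t, x)))) t) ∧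
        (∀ x, Literature.Topology.FourManifolds.LefschetzBase.rho g x ≤ 3 / 10 → ∀ t,
          ‖Literature.Topology.FourManifolds.LefschetzBase.w g (θ (t, x))‖ =
            ‖Literature.Topology.FourManifolds.LefschetzBase.w g x‖) ∧
        (∀ κ : ℝ, (∀ c, a c = κ) →
          ∀ (x : Literature.Topology.FourManifolds.LefschetzBase.Base g) (c : ℂ) (t : ℝ),
            x ∈ Literature.Topology.FourManifolds.LefschetzBase.page g c →
            R.toFun t x ∈ Literature.Topology.FourManifolds.LefschetzBase.page g
              (Complex.exp (Complex.I * κ * t) * c)) := by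
  intro g a ha
  obtain ⟨θ, hθ, h0, hadd, hder⟩ := exists_rotFlow g ha
  have hrho : ∀ t x, rho g (θ (t, x)) = rho g x := fun t x => by
    have h := rho_flowline_eq (hder x) t
    rwa [h0] at h
  refine ⟨baseIsotopy hrho h0 hadd hθ, θ, hθ, h0, hadd, fun t x => rfl, hrho, fun t x => ?_,
    fun x hx t => ?_, fun x hx t => ?_, fun κ hκ x c t hxc => ?_⟩
  · have h := norm_sq_cx_flowline_lt_four_iff (hder x) t
    rwa [h0] at h
  · have h := hasDerivAt_w_flowline (hder x) (by rwa [h0]) t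
    exact h
  · have h := norm_w_flowline_eq (hder x) (by rwa [h0]) t
    rwa [h0] at h
  · obtain ⟨hx4, hxw⟩ := hxc
    have hρ : rho g (θ (0, x.1)) ≤ 3 / 10 := by
      rw [h0]; exact x.2.trans (by norm_num)
    refine ⟨?_, ?_⟩
    · show ‖cx (θ (t, x.1))‖ ^ 2 < 4
      rw [norm_sq_cx_flowline_lt_four_iff (hder x.1) t, h0]
      exact hx4
    · show w g (θ (t, x.1)) = Complex.exp (Complex.I * κ * t) * c / 2
      rw [w_flowline_eq_exp_mul (hder x.1) hρ (fun s => hκ _) t, h0, hxw, mul_div_assoc]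

end Summit.SmoothPoincare4.SmoothPoincare4.Theorems.AcyclicBisectionExists.ModpBraidOrbits
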